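import Summits.Ventures.CertifiedArithmetic.LowPrec.PatternEnvelopeMul

/-!
# Pattern route of Theorem E5, part 2b: the product constants of the four roundings are sound
# and sharp

HONEST FRAMING (venture CertifiedArithmetic / cell `pub-lowprec`): certified error envelopes and
provably optimal rounding/accumulation schemes for low-precision formats under stated cost models;
every table by two implementations; no hardware or vendor claims.

THEOREMS-R1 Theorem E5, bookkeeping half, products `X · Y → R` (any three binary formats): the
schemas of `PatternEnvelopeMul.lean` instantiated with the pattern bridges of
`PatternBridge.lean` for the four roundings of the enumeration tables. For EVERY `X, Y, R`:
* nearest — `|RNE(a·b) - a·b| ≤ envconstMulNE X Y R · |a·b|` on the normal range of `R`, attained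
  (`mul_relNE_le_envconst`, `mul_relNE_attained`);
* toward zero — constant `envconstMulTZ X Y R` (`mul_relTZ_le_envconst`, `mul_relTZ_attained`);
* round down and round up — ONE constant `envconstMulDir X Y R` for both columns (toward-zero
  pattern error on one sign of the product, away error on the other; attained at the sign where
  the larger of the two lives: `mul_relRD/RU_le_envconst`, `mul_relRD/RU_attained`), which is the
  pattern-level form of `c_RD = c_RU = max(c_towardzero, c_away)` (`DirectedRDColumn.lean`).
The corollaries `mul_relNE/TZ/RD/RU_normal_of_envconst` put a computed constant into the exact
shape of the kernel-exhaustive table theorems (`EnvelopesDirected*.lean`: bound over all operand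
pairs on `lo ≤ |t| ≤ maxRat` plus a maximiser), so that a per-key theorem costs three `decide`s
on pattern-level quantities and no operand-pair enumeration (`PatternEnvelopeMulFP6FP4.lean`).

Placement: venture development under `Summits/Ventures/CertifiedArithmetic/`; declarations extend
the Literature structure `MiniFloat` (CONVENTIONS §2). New work of the venture (elementary;
[folklore] tags, cf. [cite: Higham2002ASNA, §2.1]).
-/

namespace Literature.ComputerArithmetic.FloatingPoint

open Format

namespace MiniFloat

variable {X Y : Format}

/-! ### The four roundings -/

/-- SOUNDNESS, NEAREST: on the normal range of `R`, `|RNE(a·b) - a·b| ≤ envconstMulNE X Y R · |a·b|`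
for all data `a : X`, `b : Y`. [folklore] -/
theorem mul_relNE_le_envconst (R : Format) (a : MiniFloat X) (b : MiniFloat Y)
    (hlo : 2 ^ R.manBits * R.quantum ≤ |a.toRat * b.toRat|)
    (hhi : |a.toRat * b.toRat| ≤ R.maxRat) :
    |(roundNE R (a.toRat * b.toRat)).toRat - a.toRat * b.toRat|
      ≤ envconstMulNE X Y R * |a.toRat * b.toRat| :=
  mul_rel_le_of_bridge R (roundNE R) patRelErrNE
    (fun _ _ _ hF ht hlo hhi => (relErr_roundNE_of_scaled hF ht hlo hhi).le) a b hlo hhi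

/-- ATTAINMENT, NEAREST: `envconstMulNE X Y R` is attained by an in-range product. [folklore] -/
theorem mul_relNE_attained (R : Format) (hne : mulPatErrs patRelErrNE X Y R ≠ []) :
    ∃ (a : MiniFloat X) (b : MiniFloat Y), 2 ^ R.manBits * R.quantum ≤ |a.toRat * b.toRat| ∧
      |a.toRat * b.toRat| ≤ R.maxRat ∧
      |(roundNE R (a.toRat * b.toRat)).toRat - a.toRat * b.toRat|
        = envconstMulNE X Y R * |a.toRat * b.toRat| :=
  mul_rel_attained_of_bridge R (roundNE R) patRelErrNE (fun _ => false)
    (fun N => patRelErrNE_nonneg _ N)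
    (fun _ _ _ _ _ hF ht hlo hhi => relErr_roundNE_of_scaled hF ht hlo hhi) hne

/-- SOUNDNESS, TOWARD ZERO: `|RZ(a·b) - a·b| ≤ envconstMulTZ X Y R · |a·b|` on the normal range.
[folklore] -/
theorem mul_relTZ_le_envconst (R : Format) (a : MiniFloat X) (b : MiniFloat Y)
    (hlo : 2 ^ R.manBits * R.quantum ≤ |a.toRat * b.toRat|)
    (hhi : |a.toRat * b.toRat| ≤ R.maxRat) :
    |(roundTowardZero R (a.toRat * b.toRat)).toRat - a.toRat * b.toRat|
      ≤ envconstMulTZ X Y R * |a.toRat * b.toRat| :=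
  mul_rel_le_of_bridge R (roundTowardZero R) patRelErrTZ
    (fun _ _ _ hF ht hlo hhi => (relErr_roundTowardZero_of_scaled hF ht hlo hhi).le) a b hlo hhi

/-- ATTAINMENT, TOWARD ZERO. [folklore] -/
theorem mul_relTZ_attained (R : Format) (hne : mulPatErrs patRelErrTZ X Y R ≠ []) :
    ∃ (a : MiniFloat X) (b : MiniFloat Y), 2 ^ R.manBits * R.quantum ≤ |a.toRat * b.toRat| ∧
      |a.toRat * b.toRat| ≤ R.maxRat ∧
      |(roundTowardZero R (a.toRat * b.toRat)).toRat - a.toRat * b.toRat|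
        = envconstMulTZ X Y R * |a.toRat * b.toRat| :=
  mul_rel_attained_of_bridge R (roundTowardZero R) patRelErrTZ (fun _ => false)
    (fun N => patRelErrTZ_nonneg _ N)
    (fun _ _ _ _ _ hF ht hlo hhi => relErr_roundTowardZero_of_scaled hF ht hlo hhi) hne

/-- SOUNDNESS, ROUND DOWN: `|RD(a·b) - a·b| ≤ envconstMulDir X Y R · |a·b|` on the normal range
(toward-zero pattern error at `a·b > 0`, away error at `a·b < 0`). [folklore] -/
theorem mul_relRD_le_envconst (R : Format) (a : MiniFloat X) (b : MiniFloat Y)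
    (hlo : 2 ^ R.manBits * R.quantum ≤ |a.toRat * b.toRat|)
    (hhi : |a.toRat * b.toRat| ≤ R.maxRat) :
    |(roundDown R (a.toRat * b.toRat)).toRat - a.toRat * b.toRat|
      ≤ envconstMulDir X Y R * |a.toRat * b.toRat| :=
  mul_rel_le_of_bridge R (roundDown R) patRelErrDir
    (fun t _ _ hF ht hlo hhi => by
      rcases lt_or_gt_of_ne (ne_zero_of_normal hlo) with hneg | hpos
      · rw [relErr_roundDown_of_scaled_neg hneg hF ht hlo hhi]; exact le_max_right _ _
      · rw [relErr_roundDown_of_scaled_pos hpos hF ht hlo hhi]; exact le_max_left _ _) a b hlo hhi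

/-- ATTAINMENT, ROUND DOWN (at a negative product when the away error of the maximising pattern
exceeds its toward-zero error, else at a positive one). [folklore] -/
theorem mul_relRD_attained (R : Format) (hne : mulPatErrs patRelErrDir X Y R ≠ []) :
    ∃ (a : MiniFloat X) (b : MiniFloat Y), 2 ^ R.manBits * R.quantum ≤ |a.toRat * b.toRat| ∧
      |a.toRat * b.toRat| ≤ R.maxRat ∧
      |(roundDown R (a.toRat * b.toRat)).toRat - a.toRat * b.toRat|
        = envconstMulDir X Y R * |a.toRat * b.toRat| :=
  mul_rel_attained_of_bridge R (roundDown R) patRelErrDir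
    (fun N => decide (R.patRelErrTZ (mulFuel X Y) N < R.patRelErrAW (mulFuel X Y) N))
    (fun N => patRelErrDir_nonneg _ N)
    (fun t N _ hne0 hsgn hF ht hlo hhi => by
      by_cases h : R.patRelErrTZ (mulFuel X Y) N < R.patRelErrAW (mulFuel X Y) N
      · rw [relErr_roundDown_of_scaled_neg (hsgn.mpr (decide_eq_true h)) hF ht hlo hhi]
        exact (max_eq_right h.le).symm
      · have hpos : 0 < t := by
          rcases lt_or_gt_of_ne hne0 with hneg | hpos
          · exact absurd (of_decide_eq_true (hsgn.mp hneg)) h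
          · exact hpos
        rw [relErr_roundDown_of_scaled_pos hpos hF ht hlo hhi]
        exact (max_eq_left (not_lt.mp h)).symm) hne

/-- SOUNDNESS, ROUND UP: the same constant `envconstMulDir X Y R` (mirror image of round down).
[folklore] -/
theorem mul_relRU_le_envconst (R : Format) (a : MiniFloat X) (b : MiniFloat Y)
    (hlo : 2 ^ R.manBits * R.quantum ≤ |a.toRat * b.toRat|)
    (hhi : |a.toRat * b.toRat| ≤ R.maxRat) :
    |(roundUp R (a.toRat * b.toRat)).toRat - a.toRat * b.toRat|
      ≤ envconstMulDir X Y R * |a.toRat * b.toRat| :=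
  mul_rel_le_of_bridge R (roundUp R) patRelErrDir
    (fun t _ _ hF ht hlo hhi => by
      rcases lt_or_gt_of_ne (ne_zero_of_normal hlo) with hneg | hpos
      · rw [relErr_roundUp_of_scaled_neg hneg hF ht hlo hhi]; exact le_max_left _ _
      · rw [relErr_roundUp_of_scaled_pos hpos hF ht hlo hhi]; exact le_max_right _ _) a b hlo hhi

/-- ATTAINMENT, ROUND UP. [folklore] -/
theorem mul_relRU_attained (R : Format) (hne : mulPatErrs patRelErrDir X Y R ≠ []) :
    ∃ (a : MiniFloat X) (b : MiniFloat Y), 2 ^ R.manBits * R.quantum ≤ |a.toRat * b.toRat| ∧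
      |a.toRat * b.toRat| ≤ R.maxRat ∧
      |(roundUp R (a.toRat * b.toRat)).toRat - a.toRat * b.toRat|
        = envconstMulDir X Y R * |a.toRat * b.toRat| :=
  mul_rel_attained_of_bridge R (roundUp R) patRelErrDir
    (fun N => decide (R.patRelErrAW (mulFuel X Y) N < R.patRelErrTZ (mulFuel X Y) N))
    (fun N => patRelErrDir_nonneg _ N)
    (fun t N _ hne0 hsgn hF ht hlo hhi => by
      by_cases h : R.patRelErrAW (mulFuel X Y) N < R.patRelErrTZ (mulFuel X Y) N
      · rw [relErr_roundUp_of_scaled_neg (hsgn.mpr (decide_eq_true h)) hF ht hlo hhi]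
        exact (max_eq_left h.le).symm
      · have hpos : 0 < t := by
          rcases lt_or_gt_of_ne hne0 with hneg | hpos
          · exact absurd (of_decide_eq_true (hsgn.mp hneg)) h
          · exact hpos
        rw [relErr_roundUp_of_scaled_pos hpos hF ht hlo hhi]
        exact (max_eq_right (not_lt.mp h)).symm) hne

/-! ### Table shape: a computed constant gives the per-key theorem -/

/-- TABLE SHAPE, NEAREST: from `2^m · quantum_R = lo`, `envconstMulNE X Y R = c` and one placeable
pattern, the per-key statement "bound `c` on `lo ≤ |t| ≤ maxRat` over all operand pairs, and a
maximiser". [folklore] -/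
theorem mul_relNE_normal_of_envconst (R : Format) {lo c : ℚ}
    (hlo : 2 ^ R.manBits * R.quantum = lo) (hc : envconstMulNE X Y R = c)
    (hne : mulPatErrs patRelErrNE X Y R ≠ []) :
    (∀ (a : MiniFloat X) (b : MiniFloat Y), lo ≤ |a.toRat * b.toRat| →
        |a.toRat * b.toRat| ≤ R.maxRat →
          |(roundNE R (a.toRat * b.toRat)).toRat - a.toRat * b.toRat|
            ≤ c * |a.toRat * b.toRat|) ∧
      ∃ (a : MiniFloat X) (b : MiniFloat Y), lo ≤ |a.toRat * b.toRat| ∧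
        |a.toRat * b.toRat| ≤ R.maxRat ∧
          |(roundNE R (a.toRat * b.toRat)).toRat - a.toRat * b.toRat|
            = c * |a.toRat * b.toRat| := by
  subst hlo hc
  exact ⟨fun a b h1 h2 => mul_relNE_le_envconst R a b h1 h2, mul_relNE_attained R hne⟩

/-- TABLE SHAPE, TOWARD ZERO. [folklore] -/
theorem mul_relTZ_normal_of_envconst (R : Format) {lo c : ℚ}
    (hlo : 2 ^ R.manBits * R.quantum = lo) (hc : envconstMulTZ X Y R = c)
    (hne : mulPatErrs patRelErrTZ X Y R ≠ []) :
    (∀ (a : MiniFloat X) (b : MiniFloat Y), lo ≤ |a.toRat * b.toRat| →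
        |a.toRat * b.toRat| ≤ R.maxRat →
          |(roundTowardZero R (a.toRat * b.toRat)).toRat - a.toRat * b.toRat|
            ≤ c * |a.toRat * b.toRat|) ∧
      ∃ (a : MiniFloat X) (b : MiniFloat Y), lo ≤ |a.toRat * b.toRat| ∧
        |a.toRat * b.toRat| ≤ R.maxRat ∧
          |(roundTowardZero R (a.toRat * b.toRat)).toRat - a.toRat * b.toRat|
            = c * |a.toRat * b.toRat| := by
  subst hlo hc
  exact ⟨fun a b h1 h2 => mul_relTZ_le_envconst R a b h1 h2, mul_relTZ_attained R hne⟩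

/-- TABLE SHAPE, ROUND DOWN. [folklore] -/
theorem mul_relRD_normal_of_envconst (R : Format) {lo c : ℚ}
    (hlo : 2 ^ R.manBits * R.quantum = lo) (hc : envconstMulDir X Y R = c)
    (hne : mulPatErrs patRelErrDir X Y R ≠ []) :
    (∀ (a : MiniFloat X) (b : MiniFloat Y), lo ≤ |a.toRat * b.toRat| →
        |a.toRat * b.toRat| ≤ R.maxRat →
          |(roundDown R (a.toRat * b.toRat)).toRat - a.toRat * b.toRat|
            ≤ c * |a.toRat * b.toRat|) ∧
      ∃ (a : MiniFloat X) (b : MiniFloat Y), lo ≤ |a.toRat * b.toRat| ∧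
        |a.toRat * b.toRat| ≤ R.maxRat ∧
          |(roundDown R (a.toRat * b.toRat)).toRat - a.toRat * b.toRat|
            = c * |a.toRat * b.toRat| := by
  subst hlo hc
  exact ⟨fun a b h1 h2 => mul_relRD_le_envconst R a b h1 h2, mul_relRD_attained R hne⟩

/-- TABLE SHAPE, ROUND UP. [folklore] -/
theorem mul_relRU_normal_of_envconst (R : Format) {lo c : ℚ}
    (hlo : 2 ^ R.manBits * R.quantum = lo) (hc : envconstMulDir X Y R = c)
    (hne : mulPatErrs patRelErrDir X Y R ≠ []) :
    (∀ (a : MiniFloat X) (b : MiniFloat Y), lo ≤ |a.toRat * b.toRat| →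
        |a.toRat * b.toRat| ≤ R.maxRat →
          |(roundUp R (a.toRat * b.toRat)).toRat - a.toRat * b.toRat|
            ≤ c * |a.toRat * b.toRat|) ∧
      ∃ (a : MiniFloat X) (b : MiniFloat Y), lo ≤ |a.toRat * b.toRat| ∧
        |a.toRat * b.toRat| ≤ R.maxRat ∧
          |(roundUp R (a.toRat * b.toRat)).toRat - a.toRat * b.toRat|
            = c * |a.toRat * b.toRat| := by
  subst hlo hc
  exact ⟨fun a b h1 h2 => mul_relRU_le_envconst R a b h1 h2, mul_relRU_attained R hne⟩

end MiniFloat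

end Literature.ComputerArithmetic.FloatingPoint
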